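import Summits.NavierStokesRegularity.FunctionalMining.NonlinearPoincareHolderMap
import Summits.NavierStokesRegularity.FunctionalMining.VorticityMomentViscous
import HarnessLib

/-!
# FunctionalMining — K0 rows `E.q|T_LD|G1` at REAL `q`: the five static inputs on `T³`

Search for candidate a priori estimates; no regularity claim. Cell `pub-nsfunc`, prove seat
(gen 9). Static inequalities for a smooth divergence-free `v` on `T³ = UnitAddTorus (Fin 3)`,
`ω = curl v` (smooth, zero-mean), real `q > 2`, `A_r = ∫‖ω‖^r` (real powers), `F = A_q`,
`g = ∑ₖ‖∂ₖv‖²`, `G = ∫g^q`, `I = ∫‖ω‖^{q−2}∑ₖ‖∂ₖω‖²`, `X = ∫(|ω|²)^{q/2−1}σ`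
(the production of the exact `Z_q` balance):

1. `|X| ≤ √2 ∫‖ω‖^{q−1} g` (pointwise `σ² ≤ 2|ω|²g²`, `VorticityL4.stretchingDensity_sq_le`);
2. Hölder `(q−1)/q + 1/q = 1`: `∫‖ω‖^{q−1}g ≤ F^{(q−1)/q} G^{1/q}`;
3. Calderón–Zygmund at `s = 2q` (tree `Torus.exists_gradLs_le_vorticityLs`): `G ≤ K^{2q} A_{2q}`;
4. Cauchy–Schwarz `A_{2q}² ≤ F A_{3q}`;
5. outward interpolation `F ≤ Z^θ A_{3q}^{1−θ}`, `θ = 2q/(3q−2)` (Hölder).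

With the top node `A_{3q} ≤ C I³` (file `SobolevTopRpow`, `a = (q−2)/2`) these are the inputs of the
SIEVELD §3.2 closure at the `T_LD` exponents (sequel `VorticityMomentProduction`).

## Main statements

* `abs_production_le`, `holder_production_le`, `exists_cz_rpow`, `moment_two_q_sq_le`,
  `moment_q_le_interp`.
-/

noncomputable section

open MeasureTheory Finset Set
open scoped InnerProductSpace RealInnerProductSpace ContDiff

namespace Summit.NavierStokesRegularity.FunctionalMining

open Literature.Analysis.FunctionSpaces Literature.Analysis.FunctionSpaces.Torus
  Literature.Analysis.FluidPDE

namespace VorticityMoment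

open VorticityL4 NonlinearPoincare

/-- Continuity of `x ↦ ‖ω(x)‖^r` for `r ≥ 0`. [folklore] -/
theorem continuous_norm_curl_rpow {v : UnitAddTorus (Fin 3) → EuclideanSpace ℝ (Fin 3)}
    (hv : IsSmooth v) {r : ℝ} (hr : 0 ≤ r) : Continuous fun x => ‖BDSV.curl v x‖ ^ r :=
  (BDSV.isSmooth_curl hv).continuous.norm.rpow_const fun _ => Or.inr hr

/-! ## 1. The pointwise bound and its integral -/

/-- **`|X| ≤ √2 ∫‖ω‖^{q−1}∑ₖ‖∂ₖv‖²`** for smooth `v` on `T³` and real `q ≥ 2`: pointwise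
`|(|ω|²)^{q/2−1}σ| ≤ (|ω|²)^{q/2−1} √(2|ω|²) g = √2 ‖ω‖^{q−1} g`. [ours] -/
theorem abs_production_le {v : UnitAddTorus (Fin 3) → EuclideanSpace ℝ (Fin 3)} (hv : IsSmooth v)
    {q : ℝ} (hq : 2 ≤ q) :
    |∫ x, torusVorticitySqAt v x ^ (q / 2 - 1) * torusStretchingDensity v x| ≤
      Real.sqrt 2 * ∫ x, ‖BDSV.curl v x‖ ^ (q - 1) * ∑ k, ‖partialDeriv k v x‖ ^ 2 := by
  have hg0 : ∀ x, 0 ≤ ∑ k, ‖partialDeriv k v x‖ ^ 2 := fun x =>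
    Finset.sum_nonneg fun k _ => sq_nonneg _
  have hpt : ∀ x, |torusVorticitySqAt v x ^ (q / 2 - 1) * torusStretchingDensity v x| ≤
      Real.sqrt 2 * (‖BDSV.curl v x‖ ^ (q - 1) * ∑ k, ‖partialDeriv k v x‖ ^ 2) := by
    intro x
    have hQ0 : 0 ≤ torusVorticitySqAt v x := torusVorticitySqAt_nonneg v x
    have hσ : |torusStretchingDensity v x| ≤
        Real.sqrt 2 * ‖BDSV.curl v x‖ * ∑ k, ‖partialDeriv k v x‖ ^ 2 := by
      have h := stretchingDensity_sq_le v x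
      have hrhs : 0 ≤ Real.sqrt 2 * ‖BDSV.curl v x‖ * ∑ k, ‖partialDeriv k v x‖ ^ 2 := by
        positivity
      have e : (Real.sqrt 2 * ‖BDSV.curl v x‖ * ∑ k, ‖partialDeriv k v x‖ ^ 2) ^ 2 =
          2 * torusVorticitySqAt v x * (∑ k, ‖partialDeriv k v x‖ ^ 2) ^ 2 := by
        rw [mul_pow, mul_pow, Real.sq_sqrt (by norm_num : (0 : ℝ) ≤ 2), norm_curl_sq]
      rw [← e] at h
      exact abs_le_of_sq_le_sq' h hrhs |>.2 |> fun h2 => by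
        have h1 := (abs_le_of_sq_le_sq' h hrhs).1
        exact abs_le.2 ⟨h1, h2⟩
    rw [abs_mul, abs_of_nonneg (Real.rpow_nonneg hQ0 _), vorticitySqAt_rpow_eq]
    have hn : 0 ≤ ‖BDSV.curl v x‖ := norm_nonneg _
    have e2 : ‖BDSV.curl v x‖ ^ (2 * (q / 2 - 1)) * ‖BDSV.curl v x‖ = ‖BDSV.curl v x‖ ^ (q - 1) := by
      rcases eq_or_lt_of_le hn with hz | hpos
      · rw [← hz, mul_zero, Real.zero_rpow (by linarith)]
      · rw [show q - 1 = 2 * (q / 2 - 1) + 1 by ring, Real.rpow_add hpos, Real.rpow_one]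
    calc ‖BDSV.curl v x‖ ^ (2 * (q / 2 - 1)) * |torusStretchingDensity v x|
        ≤ ‖BDSV.curl v x‖ ^ (2 * (q / 2 - 1)) *
            (Real.sqrt 2 * ‖BDSV.curl v x‖ * ∑ k, ‖partialDeriv k v x‖ ^ 2) :=
          mul_le_mul_of_nonneg_left hσ (Real.rpow_nonneg hn _)
      _ = Real.sqrt 2 * ((‖BDSV.curl v x‖ ^ (2 * (q / 2 - 1)) * ‖BDSV.curl v x‖) *
            ∑ k, ‖partialDeriv k v x‖ ^ 2) := by ring
      _ = Real.sqrt 2 * (‖BDSV.curl v x‖ ^ (q - 1) * ∑ k, ‖partialDeriv k v x‖ ^ 2) := by rw [e2]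
  have hc : Continuous fun x => ‖BDSV.curl v x‖ ^ (q - 1) * ∑ k, ‖partialDeriv k v x‖ ^ 2 :=
    (continuous_norm_curl_rpow hv (by linarith)).mul (continuous_gradSq hv)
  calc |∫ x, torusVorticitySqAt v x ^ (q / 2 - 1) * torusStretchingDensity v x|
      ≤ ∫ x, |torusVorticitySqAt v x ^ (q / 2 - 1) * torusStretchingDensity v x| :=
        abs_integral_le_integral_abs
    _ ≤ ∫ x, Real.sqrt 2 * (‖BDSV.curl v x‖ ^ (q - 1) * ∑ k, ‖partialDeriv k v x‖ ^ 2) :=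
        integral_mono_of_nonneg (ae_of_all _ fun x => abs_nonneg _)
          ((hc.const_mul _).integrable_unitAddTorus) (ae_of_all _ hpt)
    _ = Real.sqrt 2 * ∫ x, ‖BDSV.curl v x‖ ^ (q - 1) * ∑ k, ‖partialDeriv k v x‖ ^ 2 :=
        integral_const_mul _ _

/-! ## 2. Hölder for the production -/

/-- **Hölder**: `∫‖ω‖^{q−1}g ≤ (∫‖ω‖^q)^{(q−1)/q} (∫g^q)^{1/q}` for real `q > 1`. [folklore] -/
theorem holder_production_le {v : UnitAddTorus (Fin 3) → EuclideanSpace ℝ (Fin 3)}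
    (hv : IsSmooth v) {q : ℝ} (hq : 1 < q) :
    ∫ x, ‖BDSV.curl v x‖ ^ (q - 1) * ∑ k, ‖partialDeriv k v x‖ ^ 2 ≤
      (∫ x, ‖BDSV.curl v x‖ ^ q) ^ ((q - 1) / q) *
        (∫ x, (∑ k, ‖partialDeriv k v x‖ ^ 2) ^ q) ^ (1 / q) := by
  have hq0 : 0 < q := by linarith
  have hq0' : q ≠ 0 := hq0.ne'
  have hq1' : q - 1 ≠ 0 := by
    intro h; linarith
  have ha : 0 < (q - 1) / q := div_pos (by linarith) hq0
  have hb : 0 < 1 / q := div_pos one_pos hq0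
  have hab : (q - 1) / q + 1 / q = 1 := by field_simp; ring
  have hg0 : ∀ x, 0 ≤ ∑ k, ‖partialDeriv k v x‖ ^ 2 := fun x =>
    Finset.sum_nonneg fun k _ => sq_nonneg _
  have h := integral_mul_le_rpow_mul_rpow (continuous_norm_curl_rpow hv (r := q - 1) (by linarith))
    (continuous_gradSq hv) (fun x => Real.rpow_nonneg (norm_nonneg _) _) hg0 ha hb hab
  have e1 : ∀ x, (‖BDSV.curl v x‖ ^ (q - 1)) ^ ((q - 1) / q)⁻¹ = ‖BDSV.curl v x‖ ^ q := by
    intro x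
    rw [← Real.rpow_mul (norm_nonneg _)]
    congr 1
    field_simp
  have e2 : ∀ x, (∑ k, ‖partialDeriv k v x‖ ^ 2) ^ (1 / q)⁻¹ = (∑ k, ‖partialDeriv k v x‖ ^ 2) ^ q :=
    fun x => by rw [one_div, inv_inv]
  simp only [e1, e2] at h
  exact h

/-! ## 3. Calderón–Zygmund at `s = 2q` in real-power form -/

/-- **Calderón–Zygmund at `s = 2q`, real powers.** For real `q > 1/2` there is `K ≥ 0` with
`∫ (∑ₖ‖∂ₖv‖²)^q ≤ K ∫ ‖curl v‖^{2q}` for every smooth divergence-free `v : T³ → ℝ³` — the tree's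
`Torus.exists_gradLs_le_vorticityLs` at `s = 2q` (`(√g)^{2q} = g^q`, `(√|ω|²)^{2q} = ‖curl v‖^{2q}`),
raised to the power `2q`. [cite: MajdaBertozziCUP2002, §11.1 eq. (11.9) with Prop. 10.6] -/
theorem exists_cz_rpow {q : ℝ} (hq : 1 / 2 < q) :
    ∃ K : ℝ, 0 ≤ K ∧ ∀ v : UnitAddTorus (Fin 3) → EuclideanSpace ℝ (Fin 3), IsSmooth v →
      IsDivFree v →
      ∫ x, (∑ k, ‖partialDeriv k v x‖ ^ 2) ^ q ≤ K * ∫ x, ‖BDSV.curl v x‖ ^ (2 * q) := by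
  have hs : 1 < 2 * q := by linarith
  have hs0 : 0 < 2 * q := by linarith
  obtain ⟨K, hK0, hK⟩ := Torus.exists_gradLs_le_vorticityLs (s := 2 * q) hs
  refine ⟨K ^ (2 * q), Real.rpow_nonneg hK0 _, fun v hv hdiv => ?_⟩
  have h := hK v hv hdiv
  have hg0 : ∀ x, 0 ≤ ∑ k, ‖partialDeriv k v x‖ ^ 2 := fun x =>
    Finset.sum_nonneg fun k _ => sq_nonneg _
  have e1 : ∫ x, Real.sqrt (∑ j, ‖partialDeriv j v x‖ ^ 2) ^ (2 * q) =
      ∫ x, (∑ k, ‖partialDeriv k v x‖ ^ 2) ^ q :=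
    integral_congr_ae (ae_of_all _ fun x => by
      show Real.sqrt (∑ j, ‖partialDeriv j v x‖ ^ 2) ^ (2 * q) = (∑ k, ‖partialDeriv k v x‖ ^ 2) ^ q
      rw [Real.sqrt_eq_rpow, ← Real.rpow_mul (hg0 x)]
      congr 1; ring)
  have e2 : ∫ x, Real.sqrt (torusVorticitySqAt v x) ^ (2 * q) = ∫ x, ‖BDSV.curl v x‖ ^ (2 * q) :=
    integral_congr_ae (ae_of_all _ fun x => by
      show Real.sqrt (torusVorticitySqAt v x) ^ (2 * q) = ‖BDSV.curl v x‖ ^ (2 * q)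
      rw [← norm_curl_sq, Real.sqrt_sq (norm_nonneg _)])
  rw [e1, e2] at h
  obtain ⟨G, hG⟩ : ∃ G : ℝ, G = ∫ x, (∑ k, ‖partialDeriv k v x‖ ^ 2) ^ q := ⟨_, rfl⟩
  obtain ⟨A, hA⟩ : ∃ A : ℝ, A = ∫ x, ‖BDSV.curl v x‖ ^ (2 * q) := ⟨_, rfl⟩
  rw [← hG, ← hA] at h ⊢
  have hG0 : 0 ≤ G := by rw [hG]; exact integral_nonneg fun x => Real.rpow_nonneg (hg0 x) _
  have hA0 : 0 ≤ A := by rw [hA]; exact integral_nonneg fun x => Real.rpow_nonneg (norm_nonneg _) _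
  -- raise `G^{1/(2q)} ≤ K A^{1/(2q)}` to the power `2q`
  have h2 := Real.rpow_le_rpow (Real.rpow_nonneg hG0 _) h hs0.le
  rw [← Real.rpow_mul hG0, Real.mul_rpow hK0 (Real.rpow_nonneg hA0 _), ← Real.rpow_mul hA0,
    show 1 / (2 * q) * (2 * q) = 1 by field_simp, Real.rpow_one, Real.rpow_one] at h2
  exact h2

/-! ## 4. Cauchy–Schwarz `A_{2q}² ≤ F A_{3q}` -/

/-- **`(∫‖ω‖^{2q})² ≤ (∫‖ω‖^q)(∫‖ω‖^{3q})`** for real `q > 0` (Cauchy–Schwarz with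
`‖ω‖^{q/2}·‖ω‖^{3q/2}`). [folklore] -/
theorem moment_two_q_sq_le {v : UnitAddTorus (Fin 3) → EuclideanSpace ℝ (Fin 3)} (hv : IsSmooth v)
    {q : ℝ} (hq : 0 < q) :
    (∫ x, ‖BDSV.curl v x‖ ^ (2 * q)) ^ 2 ≤
      (∫ x, ‖BDSV.curl v x‖ ^ q) * ∫ x, ‖BDSV.curl v x‖ ^ (3 * q) := by
  have h := sq_integral_mul_le (f := fun x => ‖BDSV.curl v x‖ ^ (q / 2))
    (g := fun x => ‖BDSV.curl v x‖ ^ (3 * q / 2))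
    (continuous_norm_curl_rpow hv (by positivity)) (continuous_norm_curl_rpow hv (by positivity))
  have e1 : ∀ x, ‖BDSV.curl v x‖ ^ (q / 2) * ‖BDSV.curl v x‖ ^ (3 * q / 2) =
      ‖BDSV.curl v x‖ ^ (2 * q) := fun x => by
    rw [← Real.rpow_add' (norm_nonneg _) (by linarith : (0 : ℝ) < q / 2 + 3 * q / 2).ne']
    congr 1; ring
  have e2 : ∀ x, (‖BDSV.curl v x‖ ^ (q / 2)) ^ 2 = ‖BDSV.curl v x‖ ^ q := fun x => by
    rw [← Real.rpow_natCast, ← Real.rpow_mul (norm_nonneg _)]; congr 1; push_cast; ring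
  have e3 : ∀ x, (‖BDSV.curl v x‖ ^ (3 * q / 2)) ^ 2 = ‖BDSV.curl v x‖ ^ (3 * q) := fun x => by
    rw [← Real.rpow_natCast, ← Real.rpow_mul (norm_nonneg _)]; congr 1; push_cast; ring
  simp only [e1, e2, e3] at h
  exact h

/-! ## 5. Outward interpolation `F ≤ Z^θ A_{3q}^{1−θ}` -/

/-- **Lyapunov interpolation** `∫‖ω‖^q ≤ (∫‖ω‖²)^θ (∫‖ω‖^{3q})^{1−θ}`, `θ = 2q/(3q−2)`, for real
`q > 2` (Hölder with weights `θ, 1−θ`; `2θ + 3q(1−θ) = q`). [folklore] -/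
theorem moment_q_le_interp {v : UnitAddTorus (Fin 3) → EuclideanSpace ℝ (Fin 3)} (hv : IsSmooth v)
    {q : ℝ} (hq : 2 < q) :
    ∫ x, ‖BDSV.curl v x‖ ^ q ≤
      (∫ x, ‖BDSV.curl v x‖ ^ (2 : ℝ)) ^ (2 * q / (3 * q - 2)) *
        (∫ x, ‖BDSV.curl v x‖ ^ (3 * q)) ^ (1 - 2 * q / (3 * q - 2)) := by
  obtain ⟨θ, hθ⟩ : ∃ θ : ℝ, θ = 2 * q / (3 * q - 2) := ⟨_, rfl⟩
  have h3q : 0 < 3 * q - 2 := by linarith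
  have h3q' : 3 * q - 2 ≠ 0 := h3q.ne'
  have hθ0 : 0 < θ := by rw [hθ]; exact div_pos (by linarith) h3q
  have hθ1 : θ < 1 := by rw [hθ, div_lt_one h3q]; linarith
  have hθ1' : 0 < 1 - θ := by linarith
  have hθ0' : θ ≠ 0 := hθ0.ne'
  have hθ1'' : 1 - θ ≠ 0 := hθ1'.ne'
  rw [← hθ]
  have h := integral_mul_le_rpow_mul_rpow
    (f := fun x => ‖BDSV.curl v x‖ ^ (2 * θ)) (g := fun x => ‖BDSV.curl v x‖ ^ (3 * q * (1 - θ)))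
    (continuous_norm_curl_rpow hv (by positivity)) (continuous_norm_curl_rpow hv (by positivity))
    (fun x => Real.rpow_nonneg (norm_nonneg _) _) (fun x => Real.rpow_nonneg (norm_nonneg _) _)
    hθ0 hθ1' (by ring)
  have hθ' : θ * (3 * q - 2) = 2 * q := by rw [hθ, div_mul_cancel₀ _ h3q']
  have hexp : 2 * θ + 3 * q * (1 - θ) = q := by linear_combination (-1 : ℝ) * hθ'
  have e1 : ∀ x, ‖BDSV.curl v x‖ ^ (2 * θ) * ‖BDSV.curl v x‖ ^ (3 * q * (1 - θ)) =
      ‖BDSV.curl v x‖ ^ q := fun x => by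
    rw [← Real.rpow_add' (norm_nonneg _) (by rw [hexp]; linarith), hexp]
  have e2 : ∀ x, (‖BDSV.curl v x‖ ^ (2 * θ)) ^ θ⁻¹ = ‖BDSV.curl v x‖ ^ (2 : ℝ) := fun x => by
    rw [← Real.rpow_mul (norm_nonneg _)]; congr 1; field_simp
  have e3 : ∀ x, (‖BDSV.curl v x‖ ^ (3 * q * (1 - θ))) ^ (1 - θ)⁻¹ = ‖BDSV.curl v x‖ ^ (3 * q) :=
    fun x => by
    rw [← Real.rpow_mul (norm_nonneg _)]; congr 1; field_simp
  simp only [e1, e2, e3] at h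
  exact h

end VorticityMoment

end Summit.NavierStokesRegularity.FunctionalMining
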